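import Literature.AnabelianGeometry.SemiGraphs.TemperoidsHomHom
import Literature.AnabelianGeometry.SemiGraphs.NotationsConventions
import Literature.AlgebraicGeometry.Frobenioids.QuasiTemperoid

/-!
# [SemiAnbd] Thm A.4 chart route, C-S1b adapters: the Galois objects `Π/N`, `N ≤ H`, lie in the
# relative charts `B^temp(Π)[Π/H]` (both spellings), and an open subgroup contains an open normal one

Proof-only helper file (row C-S1b of `HOME/plan/L3/SUBDAG-SemiAnbd-Cor311.md`, seat abc-iut-w5-d220):
the three one-line instantiation facts the assembly of the chart route needs in order to feed
`BTemp.exists_continuousMonoidHom_of_fullSubcategory` (`QuasiTemperoidsHomHomRel.lean`) with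
`P := admitsHomTo (Π₂/H₂)` (the tree's `Over'`, [SemiAnbd] §0 `T[A]`) or
`P := admitsHomToCoset Π₂ H₂` (`BTempRel`, [FrdII] Ex. 1.3 (i)): for an open normal `N ≤ H` the orbit
map `Π/N → Π/H` exhibits `Π/N` as an object of the chart, and below every open subgroup `H` of a
tempered group there is an open normal `M₀` (Def. 3.1 (i): open normal subgroups form a basis of
neighbourhoods of `1`).  [cite: MochizukiSemiAnbd2006, Rmk 3.1.2 p.33] [cite: MochizukiSemiAnbd2006, Def 3.1(i) p.33]
-/

namespace Literature.AnabelianGeometry.SemiGraphs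

namespace BTemp

open CategoryTheory Topology

universe u

variable {G : Type u} [Group G] [TopologicalSpace G] [IsTopologicalGroup G] (hG : IsTempered G)

omit [IsTopologicalGroup G] in
include hG in
/-- Below every open subgroup of a tempered group there is an open NORMAL subgroup (Def. 3.1 (i):
the open normal subgroups form a basis of neighbourhoods of `1`). [cite: MochizukiSemiAnbd2006, Def 3.1(i) p.33] -/
theorem exists_openNormalSubgroup_le_of_isOpen (H : Subgroup G) (hH : IsOpen (H : Set G)) :
    ∃ M₀ : OpenNormalSubgroup G, M₀.toSubgroup ≤ H := by
  obtain ⟨M₀, -, hM₀⟩ := hG.basis (H : Set G) (hH.mem_nhds H.one_mem)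
  exact ⟨M₀, fun g hg => hM₀ hg⟩

/-- For an open normal `N ≤ H` (`H` open), the orbit map of the base point, `Π/N → Π/H`, `gN ↦ gH`, is a
morphism of `B^temp(Π)`. [cite: MochizukiSemiAnbd2006, Rmk 3.1.2 p.33] -/
theorem nonempty_hom_Q_quotientObj (N : OpenNormalSubgroup G) (H : Subgroup G)
    (hH : IsOpen (H : Set G)) (hNH : N.toSubgroup ≤ H) :
    Nonempty (Q hG N ⟶ BTemp.quotientObj G hG H hH) :=
  ⟨orbitMap hG (BTemp.quotientObj G hG H hH) ((1 : G) : G ⧸ H) N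
    (le_stab_quotientObj_one hG N H hH hNH)⟩

/-- Hence `Π/N` is an object of the chart `T[Π/H] = Over' (Π/H)` ([SemiAnbd] §0: objects admitting an
arrow to `Π/H`). [cite: MochizukiSemiAnbd2006, Rmk 3.1.2 p.33] -/
theorem admitsHomTo_quotientObj_Q (N : OpenNormalSubgroup G) (H : Subgroup G)
    (hH : IsOpen (H : Set G)) (hNH : N.toSubgroup ≤ H) :
    admitsHomTo (BTemp.quotientObj G hG H hH) (Q hG N) :=
  nonempty_hom_Q_quotientObj hG N H hH hNH

/-- … and an object of the chart `B^temp(Π, H) = BTempRel Π H` ([FrdII] Ex. 1.3 (i) spelling: objects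
whose underlying `Π`-set admits a map to `Π/H`). [cite: MochizukiSemiAnbd2006, Rmk 3.1.2 p.33] -/
theorem admitsHomToCoset_Q (N : OpenNormalSubgroup G) (H : Subgroup G)
    (hH : IsOpen (H : Set G)) (hNH : N.toSubgroup ≤ H) :
    Literature.AlgebraicGeometry.Frobenioids.QuasiTemperoid.admitsHomToCoset G H (Q hG N) :=
  ⟨(orbitMap hG (BTemp.quotientObj G hG H hH) ((1 : G) : G ⧸ H) N
    (le_stab_quotientObj_one hG N H hH hNH)).hom⟩

end BTemp

end Literature.AnabelianGeometry.SemiGraphs
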